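import Literature.Analysis.Fourier.TorusProductSeries
import Literature.Analysis.Fourier.TaylorOnClosedDisc
import Mathlib.Tactic
import HarnessLib

/-!
# The product class on the torus: finite sums of products of functions holomorphic near the closed disc

Calegari–Dimitrov–Tang, arXiv:2408.15403, §6.4–6.5: the damped pullback
`W(𝐳) h(z_1)⋯h(z_d) F(Φ(𝐳)) = Σ_j c_j Π_s w_{j,s}(z_s)` is a finite sum of products of
one-variable functions holomorphic on some neighbourhood of the closed unit disc, and its
`𝐳^𝛎`-coefficients are bounded by its supremum on the torus (eq. (6.21)–(6.22)). This file makes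
that class explicit: linearity of `fseries` in the coefficients (`fseries_const_mul`,
`fseries_add`, `fseries_finset_sum`), the torus expansion of a product of holomorphic functions
with coefficients `Π_s taylorCoeff (w_s) R (ν_s)` (`prod_eq_fseries`), of a finite sum of such
products (`sum_prod_eq_fseries`), and the resulting **Cauchy estimate for the product class**
(`norm_sumProdCoeff_le`): `|Σ_j c_j Π_s [z^{ν_s}] w_{j,s}| ≤ sup_{𝕋^d} |Σ_j c_j Π_s w_{j,s}|`.

No named facts.

## References

* [CalegariDimitrovTang2024] arXiv:2408.15403, §6.4 eq. (6.15), §6.5.3 eqs. (6.21)–(6.22).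
-/

noncomputable section

open Complex Metric Finset

open scoped Real NNReal

namespace Literature.Analysis.Fourier

namespace TorusCoeff

variable {d : ℕ}

/-! ### Linearity of `fseries` in the coefficients -/

/-- Scalars. [folklore] -/
theorem fseries_const_mul (c : ℂ) (a : (Fin d → ℕ) → ℂ) (θ : Fin d → ℝ) :
    fseries (fun ν => c * a ν) θ = c * fseries a θ := by
  unfold fseries
  rw [← tsum_mul_left]
  exact tsum_congr fun ν => by ring

/-- The terms of an `fseries` with absolutely summable coefficients are summable. [folklore] -/
theorem summable_fseries_terms (a : (Fin d → ℕ) → ℂ) (ha : Summable fun ν => ‖a ν‖) (θ : Fin d → ℝ) :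
    Summable fun ν => a ν * echar (fun s => (ν s : ℤ)) θ := by
  refine Summable.of_norm (ha.congr fun ν => ?_)
  rw [norm_mul, norm_echar, mul_one]

/-- Sums. [folklore] -/
theorem fseries_add (a a' : (Fin d → ℕ) → ℂ) (ha : Summable fun ν => ‖a ν‖) (ha' : Summable fun ν => ‖a' ν‖)
    (θ : Fin d → ℝ) :
    fseries (fun ν => a ν + a' ν) θ = fseries a θ + fseries a' θ := by
  unfold fseries
  rw [← (summable_fseries_terms a ha θ).tsum_add (summable_fseries_terms a' ha' θ)]
  exact tsum_congr fun ν => by ring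

/-- Absolute summability is preserved by finite linear combinations. [folklore] -/
theorem summable_norm_finset_sum {ι : Type*} (s : Finset ι) (c : ι → ℂ) (a : ι → (Fin d → ℕ) → ℂ)
    (ha : ∀ j ∈ s, Summable fun ν => ‖a j ν‖) :
    Summable fun ν => ‖∑ j ∈ s, c j * a j ν‖ := by
  refine Summable.of_nonneg_of_le (fun ν => norm_nonneg _) (fun ν => norm_sum_le _ _) ?_
  refine summable_sum fun j hj => ?_
  simp_rw [norm_mul]
  exact (ha j hj).mul_left _

/-- **Finite linear combinations**: `fseries (Σ_j c_j a_j) = Σ_j c_j fseries a_j`. [folklore] -/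
theorem fseries_finset_sum {ι : Type*} (s : Finset ι) (c : ι → ℂ) (a : ι → (Fin d → ℕ) → ℂ)
    (ha : ∀ j ∈ s, Summable fun ν => ‖a j ν‖) (θ : Fin d → ℝ) :
    fseries (fun ν => ∑ j ∈ s, c j * a j ν) θ = ∑ j ∈ s, c j * fseries (a j) θ := by
  classical
  induction s using Finset.induction_on with
  | empty => simp [fseries]
  | insert i s hi ih =>
    have hs : ∀ j ∈ s, Summable fun ν => ‖a j ν‖ := fun j hj => ha j (Finset.mem_insert_of_mem hj)
    have h1 : Summable fun ν => ‖c i * a i ν‖ := by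
      simp_rw [norm_mul]; exact (ha i (Finset.mem_insert_self i s)).mul_left _
    have h2 := summable_norm_finset_sum s c a hs
    simp_rw [Finset.sum_insert hi]
    rw [fseries_add _ _ h1 h2 θ, fseries_const_mul, ih hs]

/-! ### Products of holomorphic functions on the torus -/

/-- **A product of functions holomorphic on `|z| ≤ R` (`R > 1`) is an `fseries` on the torus** with
coefficients `Π_s [z^{ν_s}] w_s`, absolutely summable.
[cite: CalegariDimitrovTang2024, §6.4 eq. (6.15) / §6.5.3 (the torus expansion behind (6.21))] -/
theorem prod_eq_fseries (w : Fin d → ℂ → ℂ) {R : ℝ≥0} (hR : 1 < R)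
    (hw : ∀ s, DifferentiableOn ℂ (w s) (closedBall 0 R)) (θ : Fin d → ℝ) :
    ∏ s, w s (Complex.exp (2 * π * I * θ s)) = fseries (fun ν => ∏ s, taylorCoeff (w s) R (ν s)) θ := by
  have hb : ∀ s, Summable fun n => ‖taylorCoeff (w s) R n‖ := fun s =>
    summable_norm_taylorCoeff (w s) (by exact_mod_cast hR)
  rw [← prod_fseries₁_eq_fseries _ hb θ]
  refine Finset.prod_congr rfl fun s _ => ?_
  unfold fseries₁
  exact (tsum_taylorCoeff_circle hR (hw s) (θ s)).symm

/-- The coefficients `Π_s [z^{ν_s}] w_s` are absolutely summable. [folklore] -/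
theorem summable_norm_prodCoeff (w : Fin d → ℂ → ℂ) {R : ℝ} (hR : 1 < R) :
    Summable fun ν : Fin d → ℕ => ‖∏ s, taylorCoeff (w s) R (ν s)‖ :=
  summable_norm_prod_coeff _ fun s => summable_norm_taylorCoeff (w s) hR

/-- The coefficient family of a finite sum of products. [cite: CalegariDimitrovTang2024, §6.4 eq. (6.15)] -/
def sumProdCoeff {ι : Type*} (s : Finset ι) (c : ι → ℂ) (w : ι → Fin d → ℂ → ℂ) (R : ℝ)
    (ν : Fin d → ℕ) : ℂ :=
  ∑ j ∈ s, c j * ∏ t, taylorCoeff (w j t) R (ν t)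

/-- **Finite sums of products** are `fseries` with coefficients `sumProdCoeff`.
[cite: CalegariDimitrovTang2024, §6.4 eq. (6.15)] -/
theorem sum_prod_eq_fseries {ι : Type*} (s : Finset ι) (c : ι → ℂ) (w : ι → Fin d → ℂ → ℂ) {R : ℝ≥0}
    (hR : 1 < R) (hw : ∀ j ∈ s, ∀ t, DifferentiableOn ℂ (w j t) (closedBall 0 R)) (θ : Fin d → ℝ) :
    ∑ j ∈ s, c j * ∏ t, w j t (Complex.exp (2 * π * I * θ t)) = fseries (sumProdCoeff s c w R) θ := by
  unfold sumProdCoeff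
  rw [fseries_finset_sum s c (fun j ν => ∏ t, taylorCoeff (w j t) R (ν t))
    (fun j _ => summable_norm_prodCoeff (w j) (by exact_mod_cast hR)) θ]
  refine Finset.sum_congr rfl fun j hj => ?_
  rw [prod_eq_fseries (w j) hR (hw j hj) θ]

/-- The coefficients `sumProdCoeff` are absolutely summable. [folklore] -/
theorem summable_norm_sumProdCoeff {ι : Type*} (s : Finset ι) (c : ι → ℂ) (w : ι → Fin d → ℂ → ℂ)
    {R : ℝ} (hR : 1 < R) : Summable fun ν => ‖sumProdCoeff s c w R ν‖ :=
  summable_norm_finset_sum s c _ fun j _ => summable_norm_prodCoeff (w j) hR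

/-- **The Cauchy estimate for the product class** (CDT eq. (6.22) for `W G = Σ_j c_j Π w_{j,s}`):
every coefficient is bounded by the supremum on the torus.
[cite: CalegariDimitrovTang2024, §6.5.3 eqs. (6.21)–(6.22)] -/
theorem norm_sumProdCoeff_le {ι : Type*} (s : Finset ι) (c : ι → ℂ) (w : ι → Fin d → ℂ → ℂ) {R : ℝ≥0}
    (hR : 1 < R) (hw : ∀ j ∈ s, ∀ t, DifferentiableOn ℂ (w j t) (closedBall 0 R)) {B : ℝ}
    (hB : ∀ θ : Fin d → ℝ, ‖∑ j ∈ s, c j * ∏ t, w j t (Complex.exp (2 * π * I * θ t))‖ ≤ B)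
    (ν₀ : Fin d → ℕ) :
    ‖sumProdCoeff s c w R ν₀‖ ≤ B := by
  refine norm_coeff_le_of_bound _ (summable_norm_sumProdCoeff s c w (by exact_mod_cast hR)) ν₀ fun θ _ => ?_
  rw [← sum_prod_eq_fseries s c w hR hw θ]
  exact hB θ

end TorusCoeff

end Literature.Analysis.Fourier
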